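import Summits.HodgeConjecture.HodgeConjecture.Theorems.HLiu418E3AntiholOfHol
import Summits.HodgeConjecture.HodgeConjecture.Theorems.HLiu418ChiSplittingMirror
import HarnessLib

/-!
# E3₂: `curveThetaHodgeTypeSigned_antihol` FOLLOWS FROM `curveThetaHodgeTypeSigned_hol` — the conjugate-partner hypothesis discharged

Cell `hodgecm-mathlib`, floor 0, programme P5 (`Cruxes/HLiu418/Lines/F0_AlbCm.lean`, parent stub `stub_S1b_facts : E3hol ∧ E3antihol`), crux item
`stmt-HodgeConjecture-24832` (`HCCMUnconditional.HLiu418`).  THEOREMS ONLY (no definition, no named fact, no instance, no `sorry`).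

★ `HLiu418E3AntiholOfHol.curveThetaHodgeTypeSigned_antihol_of_hol_of_conjPartner` reduced the antiholomorphic half of [Liu2021, Rem. D.5] to the
holomorphic half modulo the displayed hypothesis `hO` — the rank-2 conjugate partner `\overline{ω(λ, ⟨a⟩, χ)} ≅ ω(λ′, ⟨−a⟩, χ̄)`, `Φ_{λ′} = Φ̄_λ`, in the
letters' currency.  ROAD U of this seat (★ `HLiu418DoubledWeilMirrorPrep` ∕ `HLiu418DoubledWeilMirror` ∕ `HLiu418UndoublingMirror` ∕
`HLiu418ChiSplittingMirror`: the scalar-conjugate mirror of the `χ`-normalised doubled Weil representation is `χ⁻¹`-normalised, undoubling commutes with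
the mirror, uniqueness [Kudla1994, Thm. 3.1]) proves that partner in EVERY rank (★ `exists_conjPartner_omegaAtLine_neg`, `λ′ = λᶜ`); here it is
instantiated at `N = 2`:

* **`curveThetaHodgeTypeSigned_antihol_of_hol : curveThetaHodgeTypeSigned_hol → curveThetaHodgeTypeSigned_antihol`** — the two E3₂ named facts of
  the parent line are ONE (declared floor-0 debt −1: `stub_S1b_facts` needs `curveThetaHodgeTypeSigned_hol` only).

HC_CM is proved only modulo the 7 printed citations (+ the declared floor-0 debt) until rung 0 closes; this file discharges none of the printed citations —
it removes `curveThetaHodgeTypeSigned_antihol` from the list of INDEPENDENT named facts.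

## References
* [Liu2021] Y. Liu, Camb. J. Math. 9 (2021) = arXiv:2102.11518: Rem. D.5, App. D Lem. D.1 (2), Def. 4.12, Rem. 4.4.
* [Kudla1994] S. Kudla, Israel J. Math. 87 (1994), §3 Thm. 3.1.  [Li1992] J.-S. Li, J. reine angew. Math. 428 (1992), p. 181.
-/

set_option autoImplicit false
set_option linter.dupNamespace false

noncomputable section

namespace Summit.HodgeConjecture.HodgeConjecture.Cruxes.HLiu418.E3AntiholOfHol

open Literature.NumberTheory.Rogawski1990 (curveThetaHodgeTypeSigned_hol curveThetaHodgeTypeSigned_antihol)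
open Summit.HodgeConjecture.HodgeConjecture.Cruxes.HLiu418.DoubledWeilMirror (exists_conjPartner_omegaAtLine_neg)

/-- **E3₂-antihol ⟸ E3₂-hol, UNCONDITIONALLY**: the signed Hodge-type rule [Liu2021, Rem. D.5] for the antiholomorphic occurrence follows from the rule for
the holomorphic occurrence by complex conjugation `P ↦ P̄`, `σ ↦ σ̄`, `ω(λ,⟨a⟩,χ) ↦ ω(λᶜ,⟨−a⟩,χ̄)` (★ `exists_conjPartner_omegaAtLine_neg` at rank 2) and
the admissibility flip `ε ↦ −ε` [Liu2021, Def. 4.12, last sentence].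
[cite: Liu2021, App. D Rem. D.5 (p. 131); Lem. D.1 (2) (l. 5231); Def. 4.12; Rem. 4.4] [cite: Kudla1994, §3 Thm. 3.1] [cite: Li1992, p. 181] -/
theorem curveThetaHodgeTypeSigned_antihol_of_hol (hE3 : curveThetaHodgeTypeSigned_hol) : curveThetaHodgeTypeSigned_antihol :=
  curveThetaHodgeTypeSigned_antihol_of_hol_of_conjPartner
    (fun L _ _ _ dV hdV hdV0 _ e₁ lam hlam hw a χ => exists_conjPartner_omegaAtLine_neg L e₁ dV hdV hdV0 lam hlam hw a χ) hE3

/-- the same as an `Iff`-free implication between the two named facts, for by-name consumption (`hE3antihol := …_of_hol hE3hol`).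
[cite: Liu2021, App. D Rem. D.5 (p. 131)] -/
theorem curveThetaHodgeTypeSigned_hol_imp_antihol : curveThetaHodgeTypeSigned_hol → curveThetaHodgeTypeSigned_antihol :=
  curveThetaHodgeTypeSigned_antihol_of_hol

end Summit.HodgeConjecture.HodgeConjecture.Cruxes.HLiu418.E3AntiholOfHol

end
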